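import Literature.AnabelianGeometry.AbsoluteAnabelian.AbsTopII.TwoTripodNodalIndexEngine
import HarnessLib

/-!
# [AbsTopII] Prop 1.3 (x) at the index-`i` two-vertex datum, IV: `Prop_1_3_x''` HOLDS, node clause NON-IDLE for `i ≥ 2`

S. Mochizuki, *Topics in Absolute Anabelian Geometry II* [AbsTopII] (bib `MochizukiAbsTopII2013`; locators =
PDF pages of the kurims manuscript `paper:url-585b8d0ad0d9`), §1 Prop 1.3 (x) p. 12:

> "(x) […] if `τ_I` is non-verticial and non-edge-like, then the image of `τ_S` is the unique cusp `e_τ` of `X` such that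
> [for an appropriate choice of conjugate of `D_{e_τ}`] `τ_I(I) ⊆ D_{e_τ}`.  Now suppose that the image of `τ_S` is
> not a cusp.  Then `τ_I` satisfies the condition `τ_I(I) = I_{v_τ}` for some vertex `v_τ` if and only if the image of
> `τ_S` is a non-nodal point of the irreducible component of `X` corresponding to `v_τ`; `τ_I` is non-verticial and
> satisfies the condition `τ_I(I) ⊆ I_{e_τ}` for some node `e_τ` if and only if the image of `τ_S` is the node of `X`
> corresponding to `e_τ`."

PROOF-ONLY companion (abc-iut-f-066 gen 8, row «TWO-VERTEX-Σ-INDEX-i») of `AbsTopII/TwoTripodNodalIndexLogPoints.lean`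
(the family `M.logPointsIdx` of log points of the degenerating 4-pointed sphere with node index `i`), over the engines of
`TwoTripodNodalIndexEngine.lean`.  At abc-iut-f-066 gen 7's regular smoothing `M.dpsc` (`i_e = 1`) the node clause held
only with BOTH SIDES FALSE at every member (no log point over the node, p499084 CAVEAT); here, at node index `i ≥ 2`:

* `prop13x_logPointsIdx_node` — **Prop 1.3 (x) at a log point OVER THE NODE** (`0 < m < i`): clause 1 idle (the
  section lies in `I_e`, so it is edge-like), "`τ_I(I) = I_{v_τ}` ⇔ smooth point of `v_τ`" with both sides FALSE at both
  vertices (character engine), and the NODE clause with BOTH SIDES TRUE — the member is NON-VERTICIAL and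
  `τ_I(I) ⊆ γ I_e γ⁻¹` for some `γ ∈ Π_𝔾`;
* `prop13x_logPointsIdx_cusp`, `prop13x_logPointsIdx_smooth` — the cusp and smooth members as at `i = 1` (gen 7),
  re-proved over `I_v = closure ⟨s_j^i⟩`;
* ★★ `prop_1_3_x''_dpscIdx` — **the statement of record `DPSCIndexData.Prop_1_3_x''` HOLDS at the index-`i` two-vertex
  datum for the family `M.logPointsIdx`, every `Σ`, every `Σ`-integer `i`, NO hypothesis**; `node_clause_nonidle_dpscIdx`
  (`i ≥ 2`: a member labelled by the node at which the node clause's left-hand side is TRUE) — the CAVEAT of p499084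
  retired; `not_prop_1_3_x_dpscIdx`, `not_prop_1_3_x'_dpscIdx` (the free-label predicates still FAIL, L4-t6 certificate);
  census `exists_twoVertex_nodal_model_x''_index`.
HONEST FRAMING: classical profinite group theory at a constructed model (constructed ≠ geometric; the family is the
model's LABEL for the log points); consistency evidence for the typed row, not a discharge at geometric data; nothing here
bears on [IUTchIII] Cor 3.12; no side taken; typed ≠ proved for print's statement about all stable log curves.
-/

noncomputable section

open scoped Pointwise

namespace Literature.AnabelianGeometry.AbsoluteAnabelian.AbsTopII.TwoTripodNodal.Model

open Literature.AnabelianGeometry.SemiGraphs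
open Literature.AnabelianGeometry.SemiGraphs.SemiGraphOfAnabelioids (IsProSigmaCompletion)
open Literature.AnabelianGeometry.SemiGraphs.SemiGraphOfAnabelioids.IsProSigmaCompletion
open Literature.AnabelianGeometry.Anabelioids (IsSigmaInteger)
open Literature.GroupTheory.CombinatorialGroupTheory
open Literature.GroupTheory.CombinatorialGroupTheory.PuncturedSurfaceGroup
open _root_.Topology

variable {Sigma : Set ℕ} (M : Model Sigma) (i : ℕ)
variable (hne : Sigma.Nonempty) (hprime : ∀ p ∈ Sigma, p.Prime) (hi : IsSigmaInteger Sigma i)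

/-! ### The free-label predicates (x), (x′) FAIL at the index-`i` datum -/

/-- `I_v` of the index-`i` datum is closed. [cite: MochizukiAbsTopII2013, Prop 1.3 (iii) p.11] -/
theorem isClosed_Iv_dpscIdx (v : (M.dpscIdx hne hprime i hi).Vert) :
    IsClosed (((M.dpscIdx hne hprime i hi).Iv v : Set (M.dpscIdx hne hprime i hi).PiH)) := by
  rw [Iv_eq_vertSecIdx]; exact M.isClosed_vertSecIdx i _

/-- **`Prop_1_3_x'` (free point-kind label) is FALSE at the index-`i` datum** (two vertices, closed `I_{v_A}`, typed (iii);
abc-iut-L4-t6's certificate). [cite: MochizukiAbsTopII2013, Prop 1.3 (x) p.12] -/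
theorem not_prop_1_3_x'_dpscIdx : ¬ (M.dpscIdx hne hprime i hi).Prop_1_3_x' :=
  (M.dpscIdx hne hprime i hi).not_prop_1_3_x'_of_prop13iii (M.prop13iii_dpscIdx i hne hprime hi)
    (v := ⟨(0 : Fin 2)⟩) (w := ⟨(1 : Fin 2)⟩) (M.vert_zero_ne_one hne hprime) (M.isClosed_Iv_dpscIdx i hne hprime hi _)

/-- **`Prop_1_3_x` (free label, `Π_H`-scope) is FALSE at the index-`i` datum.** [cite: MochizukiAbsTopII2013, Prop 1.3 (x) p.12] -/
theorem not_prop_1_3_x_dpscIdx : ¬ (M.dpscIdx hne hprime i hi).Prop_1_3_x :=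
  (M.dpscIdx hne hprime i hi).not_prop_1_3_x_of_prop13iii (M.prop13iii_dpscIdx i hne hprime hi)
    (v := ⟨(0 : Fin 2)⟩) (w := ⟨(1 : Fin 2)⟩) (M.vert_zero_ne_one hne hprime) (M.isClosed_Iv_dpscIdx i hne hprime hi _)

section Node

variable {i}

/-- **The node member's section lies in a `Π_𝔾`-conjugate of `I_e = Π_e · closure ⟨t₀^i⟩`**: writing `δ = γ t`
(`γ ∈ Π_𝔾`, `t ∈ T`), `δ S_m δ⁻¹ ⊆ γ (Π_e·T) γ⁻¹ ∩ Π_I^{(i)} = γ I_e γ⁻¹`. [cite: MochizukiAbsTopII2013, Prop 1.3 (x) p.12] -/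
theorem exists_conj_nodeSection_le_conj_IvNode {m : ℕ} (hm : 0 < m) (hmi : m < i) (δ : M.P)
    (e : (M.dpscIdx hne hprime i hi).Node) :
    ∃ γ : (M.dpscIdx hne hprime i hi).PiH, γ ∈ (M.dpscIdx hne hprime i hi).PiG ∧
      (M.logPointsIdx i hne hprime hi (LogPtIdx.node m hm hmi δ)).image ≤
        MulAut.conj γ • (M.dpscIdx hne hprime i hi).IvNode e := by
  obtain ⟨γ, hγ, hle⟩ := M.exists_conj_le_conj_nodeD
    ((M.nodeSection_le_W_sup_Tpow i m).trans (sup_le_sup_left (M.Tpow_le_T i) _)) δ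
  refine ⟨γ, by rw [dpscIdx_PiG]; exact hγ, ?_⟩
  rw [logPointsIdx_node_image, IvNode_dpscIdx_eq]
  haveI := M.normal_PiIdx i
  have h1 : MulAut.conj δ • M.nodeSection i m ≤ MulAut.conj γ • ((M.nodeGp).map M.PiG.subtype ⊔ M.T) ⊓ M.PiIdx i :=
    le_inf hle (M.conj_smul_le_PiIdx i (M.nodeSection_le_PiIdx i m) δ)
  have h2 : MulAut.conj γ • ((M.nodeGp).map M.PiG.subtype ⊔ M.T) ⊓ M.PiIdx i =
      MulAut.conj γ • ((M.nodeGp).map M.PiG.subtype ⊔ M.Tpow i) := by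
    rw [← M.WT_inf_PiIdx i, Subgroup.smul_inf, Subgroup.Normal.conj_smul_eq_self γ (M.PiIdx i)]
  exact h1.trans h2.le

/-- **The node member is NON-VERTICIAL.** [cite: MochizukiAbsTopII2013, Prop 1.3 (x) p.12] -/
theorem isNonVerticial_logPointsIdx_node {m : ℕ} (hm : 0 < m) (hmi : m < i) (δ : M.P) :
    (M.logPointsIdx i hne hprime hi (LogPtIdx.node m hm hmi δ)).IsNonVerticial := by
  intro v g h
  rw [logPointsIdx_node_image, Iv_eq_vertSecIdx] at h
  exact M.not_conj_nodeSection_le_conj_vertSecIdx i hne hprime hm hmi δ v.down g h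

/-- The node member is EDGE-LIKE (its section lies in a conjugate of `I_e`), so clause 1 of Prop 1.3 (x) is idle for it.
[cite: MochizukiAbsTopII2013, Prop 1.3 (x) p.12] -/
theorem not_isNonEdgeLike_logPointsIdx_node {m : ℕ} (hm : 0 < m) (hmi : m < i) (δ : M.P) :
    ¬ (M.logPointsIdx i hne hprime hi (LogPtIdx.node m hm hmi δ)).IsNonEdgeLike := by
  intro h
  obtain ⟨γ, -, hle⟩ := M.exists_conj_nodeSection_le_conj_IvNode hne hprime hi hm hmi δ ⟨()⟩
  exact h (Sum.inl ⟨()⟩) γ hle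

/-- **The node member's section is no `Π_𝔾`-conjugate of an inertia section `I_v`** (character engine).
[cite: MochizukiAbsTopII2013, Prop 1.3 (x) p.12] -/
theorem not_image_eq_conj_Iv_logPointsIdx_node {m : ℕ} (hm : 0 < m) (hmi : m < i) (δ : M.P)
    (v : (M.dpscIdx hne hprime i hi).Vert) :
    ¬ ∃ γ : (M.dpscIdx hne hprime i hi).PiH, γ ∈ (M.dpscIdx hne hprime i hi).PiG ∧
      (M.logPointsIdx i hne hprime hi (LogPtIdx.node m hm hmi δ)).image = MulAut.conj γ • (M.dpscIdx hne hprime i hi).Iv v := by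
  rintro ⟨γ, -, h⟩
  rw [logPointsIdx_node_image, Iv_eq_vertSecIdx] at h
  exact M.not_conj_nodeSection_le_conj_vertSecIdx i hne hprime hm hmi δ v.down γ h.le

/-- ★ **Prop 1.3 (x) at a log point OVER THE NODE** (`0 < m < i`): clause 1 idle (edge-like); "`τ_I(I) = I_{v_τ}` ⇔
smooth point of `v_τ`" with both sides FALSE; the node clause "`τ_I` non-verticial ∧ `τ_I(I) ⊆ I_{e_τ}` ⇔ image is the
node `e_τ`" with BOTH SIDES TRUE. [cite: MochizukiAbsTopII2013, Prop 1.3 (x) p.12] -/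
theorem prop13x_logPointsIdx_node {m : ℕ} (hm : 0 < m) (hmi : m < i) (δ : M.P) :
    (M.logPointsIdx i hne hprime hi (LogPtIdx.node m hm hmi δ)).Prop13x := by
  refine ⟨fun _ hne' => absurd hne' (M.not_isNonEdgeLike_logPointsIdx_node hne hprime hi hm hmi δ),
    fun _ => ⟨fun v => ⟨?_, ?_⟩, fun e => ⟨fun _ => ?_, fun _ => ?_⟩⟩⟩
  · intro h; exact absurd h (M.not_image_eq_conj_Iv_logPointsIdx_node hne hprime hi hm hmi δ v)
  · intro h; rw [logPointsIdx_node_kind] at h; exact absurd h (by simp)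
  · rw [logPointsIdx_node_kind, M.node_eq hne hprime e ⟨()⟩]
  · exact ⟨M.isNonVerticial_logPointsIdx_node hne hprime hi hm hmi δ,
      M.exists_conj_nodeSection_le_conj_IvNode hne hprime hi hm hmi δ e⟩

end Node

section Cusp

variable {i}

/-- **The cusp member is NON-VERTICIAL** (`I_v(dpscIdx) ⊆ I_v(dpsc) ⊆ D_e`, then the engine with `D = D_e`).
[cite: MochizukiAbsTopII2013, Prop 1.3 (x) p.12] -/
theorem isNonVerticial_logPointsIdx_cusp (j : Fin 4) {n : ℕ} (hn : 0 < n) (δ : M.P) :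
    (M.logPointsIdx i hne hprime hi (LogPtIdx.cusp j n hn δ)).IsNonVerticial := by
  intro v g h
  rw [logPointsIdx_cusp_image, Iv_eq_vertSecIdx] at h
  obtain ⟨γ, hγ, hle⟩ := M.exists_conj_le_conj_nodeD
    ((M.vertSecIdx_le_vertSec i v.down).trans (M.vertSec_le_nodeD v.down)) g
  exact M.not_conj_cuspSectionIdx_le_conj_nodeD i hne hprime j hn δ hγ (h.trans hle)

/-- **The cusp member is NON-EDGE-LIKE** (`I_e(dpscIdx) ⊆ Π_e·T`: engine; `I_{c'} = Π_{c'} ⊆ Π_𝔾`: a section inside `Π_𝔾`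
would force `Π_I^{(i)} = Π_𝔾`). [cite: MochizukiAbsTopII2013, Prop 1.3 (x) p.12] -/
theorem isNonEdgeLike_logPointsIdx_cusp (j : Fin 4) {n : ℕ} (hn : 0 < n) (δ : M.P) :
    (M.logPointsIdx i hne hprime hi (LogPtIdx.cusp j n hn δ)).IsNonEdgeLike := by
  intro ε g h
  rcases ε with e | c'
  · -- the node: `I_e(dpscIdx) = Π_e·closure ⟨t₀^i⟩ ⊆ Π_e·T`, then the engine with `D = D_e`
    simp only [DPSCIndexData.IEdge] at h
    rw [logPointsIdx_cusp_image, IvNode_dpscIdx_eq] at h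
    obtain ⟨γ, hγ, hle⟩ := M.exists_conj_le_conj_nodeD
      (sup_le_sup_left (M.Tpow_le_T i) ((M.nodeGp).map M.PiG.subtype)) g
    exact M.not_conj_cuspSectionIdx_le_conj_nodeD i hne hprime j hn δ hγ (le_trans h hle)
  · simp only [DPSCIndexData.IEdge, DPSCData.IvCusp] at h
    haveI := (M.dpscIdx hne hprime i hi).normal_PiG
    have hG' : (M.logPointsIdx i hne hprime hi (LogPtIdx.cusp j n hn δ)).image ≤ (M.dpscIdx hne hprime i hi).PiG :=
      h.trans ((Subgroup.pointwise_smul_le_pointwise_smul_iff.mpr ((M.dpscIdx hne hprime i hi).cuspSub_le c')).trans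
        (Subgroup.Normal.conj_smul_eq_self g (M.dpscIdx hne hprime i hi).PiG).le)
    rw [dpscIdx_PiG, logPointsIdx_cusp_image] at hG'
    have hG : MulAut.conj δ • M.cuspSectionIdx i j n ≤ M.PiG := hG'
    have hbot : MulAut.conj δ • M.cuspSectionIdx i j n = ⊥ := by
      rw [← inf_eq_left.mpr hG]; exact M.conj_smul_inf_PiG_eq_bot (M.cuspSectionIdx_inf_PiG i hne hprime hi j n) δ
    have hI : M.PiIdx i = M.PiG := by
      have h2 := M.conj_smul_sup_PiG_eq_PiIdx i (M.cuspSectionIdx_sup_PiG i j n) δ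
      rw [hbot, bot_sup_eq] at h2; exact h2.symm
    apply M.Tpow_ne_bot i hne hprime hi.1
    rw [← M.Tpow_inf_PiG i, eq_comm, inf_eq_left, ← hI]
    exact M.Tpow_le_PiIdx i

/-- **Clause 1 for the cusp member, proved outright**: its label IS the cusp `c_j`, the UNIQUE cusp `c'` with
`δ S δ⁻¹ ⊆ γ D_{c'} γ⁻¹` for some `γ ∈ Π_𝔾`. [cite: MochizukiAbsTopII2013, Prop 1.3 (x) p.12] -/
theorem cusp_clause_logPointsIdx_cusp (j : Fin 4) {n : ℕ} (hn : 0 < n) (δ : M.P) :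
    ∃ e : (M.dpscIdx hne hprime i hi).Cusp,
      (M.logPointsIdx i hne hprime hi (LogPtIdx.cusp j n hn δ)).kind = DPSCIndexData.PointKind.cusp e ∧
      ∀ e' : (M.dpscIdx hne hprime i hi).Cusp,
        (∃ γ : (M.dpscIdx hne hprime i hi).PiH, γ ∈ (M.dpscIdx hne hprime i hi).PiG ∧
          (M.logPointsIdx i hne hprime hi (LogPtIdx.cusp j n hn δ)).image ≤
            MulAut.conj γ • (M.dpscIdx hne hprime i hi).DvCusp e') ↔ e' = e := by
  refine ⟨⟨j⟩, rfl, fun e' => ⟨?_, ?_⟩⟩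
  · rintro ⟨γ, hγ, hle⟩
    obtain ⟨j'⟩ := e'
    rw [dpscIdx_PiG] at hγ
    rw [logPointsIdx_cusp_image, DvCusp_dpscIdx, DvCusp_eq_sup_baseSec] at hle
    by_contra he'
    have hjj' : j' ≠ j := fun h => he' (congrArg ULift.up h)
    exact M.not_conj_cuspSectionIdx_le_conj_cuspD i hne hprime j hn δ hjj' hγ hle
  · rintro rfl
    obtain ⟨γ, hγ, s, hs, rfl⟩ := M.exists_eq_mul_of_sup_eq_top (M.baseSec_sup_PiG j) δ
    refine ⟨γ, by rw [dpscIdx_PiG]; exact hγ, ?_⟩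
    rw [logPointsIdx_cusp_image, DvCusp_dpscIdx, DvCusp_eq_sup_baseSec]
    show MulAut.conj (γ * s) • M.cuspSectionIdx i j n ≤ MulAut.conj γ • ((M.cuspGp j).map M.PiG.subtype ⊔ M.baseSec j)
    rw [map_mul, mul_smul, Subgroup.pointwise_smul_le_pointwise_smul_iff]
    calc MulAut.conj s • M.cuspSectionIdx i j n
        ≤ MulAut.conj s • ((M.cuspGp j).map M.PiG.subtype ⊔ M.baseSec j) :=
          Subgroup.pointwise_smul_le_pointwise_smul_iff.mpr (M.cuspSectionIdx_le_cuspD i hne hprime j n)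
      _ = (M.cuspGp j).map M.PiG.subtype ⊔ M.baseSec j := Subgroup.conj_smul_eq_self_of_mem (Subgroup.mem_sup_right hs)

/-- **Prop 1.3 (x) at a log point of the CUSP `c_j`** (slope `n ≥ 1`, node index `i`): clause 1 NON-IDLE, clause 2 idle.
[cite: MochizukiAbsTopII2013, Prop 1.3 (x) p.12] -/
theorem prop13x_logPointsIdx_cusp (j : Fin 4) {n : ℕ} (hn : 0 < n) (δ : M.P) :
    (M.logPointsIdx i hne hprime hi (LogPtIdx.cusp j n hn δ)).Prop13x :=
  ⟨fun _ _ => M.cusp_clause_logPointsIdx_cusp hne hprime hi j hn δ,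
    fun h => absurd (M.logPointsIdx_cusp_kind i hne hprime hi j n hn δ) (h ⟨j⟩)⟩

end Cusp

section Smooth

variable {i}

/-- The smooth member `(v, δ)` is verticial: its section IS `δ I_v δ⁻¹`. [cite: MochizukiAbsTopII2013, Prop 1.3 (x) p.12] -/
theorem not_isNonVerticial_logPointsIdx_smooth (v : Fin 2) (δ : M.P) :
    ¬ (M.logPointsIdx i hne hprime hi (LogPtIdx.smooth v δ)).IsNonVerticial := fun h =>
  h ⟨v⟩ δ (by rw [logPointsIdx_smooth_image, ← M.vertSecIdx_eq_Iv i hne hprime hi v]; exact le_rfl)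

/-- **Prop 1.3 (x) at a SMOOTH point** of `v` (node index `i`): clause 1 idle; "`τ_I(I) = I_{v_τ}` ⇔ smooth point of
`v_τ`" with both sides TRUE at `v`, both FALSE at the other vertex; node clause with both sides FALSE.
[cite: MochizukiAbsTopII2013, Prop 1.3 (x) p.12] -/
theorem prop13x_logPointsIdx_smooth (v : Fin 2) (δ : M.P) :
    (M.logPointsIdx i hne hprime hi (LogPtIdx.smooth v δ)).Prop13x := by
  refine ⟨fun hnv _ => absurd hnv (M.not_isNonVerticial_logPointsIdx_smooth hne hprime hi v δ),
    fun _ => ⟨fun w => ?_, fun e => ?_⟩⟩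
  · obtain ⟨w⟩ := w
    rw [logPointsIdx_smooth_kind]
    by_cases hvw : v = w
    · subst hvw
      refine ⟨fun _ => rfl, fun _ => ?_⟩
      obtain ⟨γ, hγ, h⟩ := M.exists_conj_vertSecIdx_eq i hne hprime v δ
      exact ⟨γ, by rw [dpscIdx_PiG]; exact hγ, by rw [logPointsIdx_smooth_image, ← M.vertSecIdx_eq_Iv i hne hprime hi v]; exact h⟩
    · constructor
      · rintro ⟨γ, -, hγ⟩
        rw [logPointsIdx_smooth_image, ← M.vertSecIdx_eq_Iv i hne hprime hi w] at hγ
        exact absurd hγ (M.conj_vertSecIdx_ne i hne hprime hi.1 v δ hvw γ)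
      · intro h
        exact absurd (congrArg ULift.down (DPSCIndexData.PointKind.smooth.inj h)) hvw
  · constructor
    · rintro ⟨hnv, -⟩
      exact absurd hnv (M.not_isNonVerticial_logPointsIdx_smooth hne hprime hi v δ)
    · intro h
      rw [logPointsIdx_smooth_kind] at h
      exact absurd h (by simp)

end Smooth

/-! ### The closers -/

/-- ★★ **[AbsTopII] Prop 1.3 (x) — statement of record `DPSCIndexData.Prop_1_3_x''` — HOLDS at the index-`i` two-vertex
nodal datum `M.dpscIdx` for the family `M.logPointsIdx` of its log points (smooth, cuspidal AND nodal members), every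
`Σ`, every `Σ`-integer `i`, NO hypothesis.** [cite: MochizukiAbsTopII2013, Prop 1.3 (x) p.12] -/
theorem prop_1_3_x''_dpscIdx : (M.dpscIdx hne hprime i hi).Prop_1_3_x'' (M.logPointsIdx i hne hprime hi) := by
  intro l
  cases l with
  | smooth v δ => exact M.prop13x_logPointsIdx_smooth hne hprime hi v δ
  | cusp j n hn δ => exact M.prop13x_logPointsIdx_cusp hne hprime hi j hn δ
  | node m hm hmi δ => exact M.prop13x_logPointsIdx_node hne hprime hi hm hmi δ

/-- ★ **The node clause is NON-IDLE at node index `i ≥ 2`**: the family has a member labelled by the node (slope `m = 1`)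
which is non-verticial and whose section lies in a `Π_𝔾`-conjugate of `I_e` — the left-hand side of "`τ_I` non-verticial
∧ `τ_I(I) ⊆ I_{e_τ}` ⇔ image of `τ_S` is the node" is TRUE there (retiring the `i_e = 1` caveat of
`TwoTripodNodalLogPoints.lean`). [cite: MochizukiAbsTopII2013, Prop 1.3 (x) p.12] -/
theorem node_clause_nonidle_dpscIdx (hi2 : 2 ≤ i) (e : (M.dpscIdx hne hprime i hi).Node) :
    ∃ l : M.LogPtIdx i, (M.logPointsIdx i hne hprime hi l).kind = DPSCIndexData.PointKind.node e ∧
      (M.logPointsIdx i hne hprime hi l).IsNonVerticial ∧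
      ∃ γ : (M.dpscIdx hne hprime i hi).PiH, γ ∈ (M.dpscIdx hne hprime i hi).PiG ∧
        (M.logPointsIdx i hne hprime hi l).image ≤ MulAut.conj γ • (M.dpscIdx hne hprime i hi).IvNode e :=
  ⟨LogPtIdx.node 1 Nat.one_pos hi2 1, by rw [logPointsIdx_node_kind, M.node_eq hne hprime e ⟨()⟩],
    M.isNonVerticial_logPointsIdx_node hne hprime hi Nat.one_pos hi2 1,
    M.exists_conj_nodeSection_le_conj_IvNode hne hprime hi Nat.one_pos hi2 1 e⟩

/-- **Census form: for every nonempty set of primes `Σ` and every `Σ`-integer `i ≥ 2`, ONE DPSC datum WITH TWO VERTICES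
and node `Σ`-index `i` at which `Prop_1_3_x`, `Prop_1_3_x'` FAIL and the statement of record `Prop_1_3_x''` HOLDS for an
honest family of log points containing smooth members at every vertex, NON-VERTICIAL NON-EDGE-LIKE members at every
cusp, AND members OVER THE NODE at which the node clause fires.** [cite: MochizukiAbsTopII2013, Prop 1.3 (x) p.12] -/
theorem exists_twoVertex_nodal_model_x''_index (Sigma : Set ℕ) (hne : Sigma.Nonempty) (hprime : ∀ p ∈ Sigma, p.Prime)
    (i : ℕ) (hi : IsSigmaInteger Sigma i) (hi2 : 2 ≤ i) :
    ∃ (X : DPSCIndexData.{0}) (L : Type) (pt : L → X.LogPointData),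
      X.Sigma = Sigma ∧ (∃ v v' : X.Vert, v ≠ v' ∧ X.Adjacent v v') ∧ (∀ e : X.Node, X.sigmaIndex e = i) ∧
      ¬ X.Prop_1_3_x ∧ ¬ X.Prop_1_3_x' ∧ X.Prop_1_3_x'' pt ∧
      (∀ v : X.Vert, ∃ l, (pt l).kind = DPSCIndexData.PointKind.smooth v) ∧
      (∀ c : X.Cusp, ∃ l, (pt l).kind = DPSCIndexData.PointKind.cusp c ∧ (pt l).IsNonVerticial ∧ (pt l).IsNonEdgeLike) ∧
      (∀ e : X.Node, ∃ l, (pt l).kind = DPSCIndexData.PointKind.node e ∧ (pt l).IsNonVerticial ∧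
        ∃ γ : X.PiH, γ ∈ X.PiG ∧ (pt l).image ≤ MulAut.conj γ • X.IvNode e) := by
  obtain ⟨M⟩ := Model.nonempty Sigma
  refine ⟨M.dpscIdx hne hprime i hi, M.LogPtIdx i, M.logPointsIdx i hne hprime hi, rfl,
    ⟨⟨(0 : Fin 2)⟩, ⟨(1 : Fin 2)⟩, M.vert_zero_ne_one hne hprime, M.adjacent_dpsc hne hprime _ _⟩, fun _ => rfl,
    M.not_prop_1_3_x_dpscIdx i hne hprime hi, M.not_prop_1_3_x'_dpscIdx i hne hprime hi,
    M.prop_1_3_x''_dpscIdx i hne hprime hi, fun v => ⟨LogPtIdx.smooth v.down 1, rfl⟩, fun c' => ?_,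
    M.node_clause_nonidle_dpscIdx i hne hprime hi hi2⟩
  exact ⟨LogPtIdx.cusp c'.down 1 Nat.one_pos 1, rfl, M.isNonVerticial_logPointsIdx_cusp hne hprime hi _ Nat.one_pos _,
    M.isNonEdgeLike_logPointsIdx_cusp hne hprime hi _ Nat.one_pos _⟩

end Literature.AnabelianGeometry.AbsoluteAnabelian.AbsTopII.TwoTripodNodal.Model

end
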